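import Literature.Geometry.Kaehler.AnalyticSet
import Literature.Analysis.Complex.OsgoodProofs
import Mathlib.Analysis.Calculus.Implicit
import Mathlib.Geometry.Manifold.MFDeriv.Atlas
import HarnessLib

/-!
# Regular points of analytic sets are locally flat: the straightening chart (holomorphic implicit function theorem)

P. Griffiths, J. Harris, *Principles of Algebraic Geometry* (1978), Ch. 0 §2 ("smooth points": "in
some neighborhood of `p`, `V` is a complex submanifold"; the holomorphic implicit function
theorem of Ch. 0 §1); E. M. Chirka, *Complex Analytic Sets* (1989), §2.3. The tree's predicate
`Literature.Geometry.Kaehler.IsRegularPointOfCodim I Z p x` (`Geometry/Kaehler/AnalyticSet`) says: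
near `x` the set `Z` is cut out by `p` holomorphic functions `f : M → ℂᵖ` with surjective
differential at `x` — "so that, by the holomorphic implicit function theorem, `Z` is a complex
submanifold of codimension `p` near `x`" (its docstring). This file PROVES that consequence in
the form of a STRAIGHTENING CHART, which is what the topology of complements consumes
(`AlgebraicTopology/SingularHomology/LocallyFlatComplement`,
`surjective_injective_map_compl_of_locallyFlat`: real codimension `2p`):

* `exists_straightening_of_hasStrictFDerivAt` — the general (real or complex, Banach) statement:
  if `φ : X ⇀ E` is an open partial homeomorphism, `g : E → F` is strictly differentiable at
  `φ x` with onto derivative `g'` (`F` finite-dimensional), and `S = {g ∘ φ = 0}` on an open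
  `W ∋ x` inside `φ.source`, then some open partial homeomorphism `e : X ⇀ F × ker g'` with
  `x ∈ e.source` straightens `S`: `z ∈ S ↔ (e z).1 = 0` on `e.source`. It is `φ|_W` followed by
  Mathlib's `HasStrictFDerivAt.implicitToOpenPartialHomeomorph g g'` (whose first component IS
  `g`).
* `IsRegularPointOfCodim.exists_straightening` — **on a complex manifold modelled on a
  finite-dimensional `E` (`𝓘(ℂ, E)`, `IsManifold … 1`), a regular point of codimension `p` of
  `Z` has a straightening chart `e : M ⇀ ℂᵖ × K` (`K = ker` of the differential in the chart at
  `x`), `z ∈ Z ↔ (e z).1 = 0` on `e.source ∋ x`.** The chart expression `g = f ∘ (chartAt x)⁻¹`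
  of the defining map is complex differentiable on an open set
  (`mdifferentiableOn_iff_of_mem_maximalAtlas`), hence ANALYTIC (the tree's Osgood lemma
  `Literature.Analysis.Complex.SCV.analyticAt_of_differentiableOn`, `Analysis/Complex/OsgoodProofs`),
  hence strictly differentiable; its derivative is the `mfderiv`, onto by hypothesis.

Everything is proved; no definitions, no named facts.

## References

* [GriffithsHarrisPrinciples1978] P. Griffiths, J. Harris, Principles of Algebraic Geometry,
  Wiley 1978, Ch. 0 §1 (implicit function theorem) and §2 (smooth points of analytic varieties).
* [Chirka1989] E. M. Chirka, Complex Analytic Sets, Kluwer 1989, §2.3.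
-/

noncomputable section

open scoped Manifold ContDiff Topology
open Set

namespace Literature.Geometry.Kaehler

/-! ### The general straightening statement -/

section General

variable {𝕜 : Type*} [NontriviallyNormedField 𝕜] [CompleteSpace 𝕜]
  {E : Type*} [NormedAddCommGroup E] [NormedSpace 𝕜 E] [CompleteSpace E]
  {F : Type*} [NormedAddCommGroup F] [NormedSpace 𝕜 F] [FiniteDimensional 𝕜 F]
  {X : Type*} [TopologicalSpace X]

/-- **Straightening a submersion-cut-out subset** (the implicit function theorem, Griffiths–Harris
Ch. 0 §1, in chart form). Let `φ : X ⇀ E` be an open partial homeomorphism, `x ∈ W ⊆ φ.source`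
with `W` open, `g : E → F` strictly differentiable at `φ x` with onto derivative `g'`, and
`S ∩ W = {z ∈ W | g (φ z) = 0}`. Then there is an open partial homeomorphism `e : X ⇀ F × ker g'`
with `x ∈ e.source` and `z ∈ S ↔ (e z).1 = 0` for all `z ∈ e.source`; namely `φ|_W` followed by
`HasStrictFDerivAt.implicitToOpenPartialHomeomorph g g'`, whose first component is `g`.
[cite: GriffithsHarrisPrinciples1978, Ch. 0 §1, implicit function theorem] -/
theorem exists_straightening_of_hasStrictFDerivAt (φ : OpenPartialHomeomorph X E) {S W : Set X}
    {x : X} (hW : IsOpen W) (hxW : x ∈ W) (hWφ : W ⊆ φ.source) {g : E → F} {g' : E →L[𝕜] F}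
    (hg : HasStrictFDerivAt g g' (φ x)) (hg' : g'.range = ⊤)
    (hS : ∀ z ∈ W, z ∈ S ↔ g (φ z) = 0) :
    ∃ e : OpenPartialHomeomorph X (F × g'.ker), x ∈ e.source ∧
      ∀ z ∈ e.source, z ∈ S ↔ (e z).1 = 0 := by
  let ψ := hg.implicitToOpenPartialHomeomorph g g' hg'
  refine ⟨(φ.restrOpen W hW).trans ψ, ?_, fun z hz ↦ ?_⟩
  · rw [OpenPartialHomeomorph.trans_source, OpenPartialHomeomorph.restrOpen_source]
    exact ⟨⟨hWφ hxW, hxW⟩, hg.mem_implicitToOpenPartialHomeomorph_source hg'⟩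
  · rw [OpenPartialHomeomorph.trans_source, OpenPartialHomeomorph.restrOpen_source] at hz
    rw [hS z hz.1.2]
    change _ ↔ (ψ (φ z)).1 = 0
    rw [hg.implicitToOpenPartialHomeomorph_fst hg']

end General

/-! ### Regular points of analytic subsets of complex manifolds -/

section Complex

variable {E : Type*} [NormedAddCommGroup E] [NormedSpace ℂ E] [FiniteDimensional ℂ E]
  {M : Type*} [TopologicalSpace M] [ChartedSpace E M] [IsManifold 𝓘(ℂ, E) 1 M]

/-- **Regular points are locally flat** (Griffiths–Harris Ch. 0 §2: near a smooth point an
analytic variety is a complex submanifold; Chirka §2.3). On a complex manifold `M` modelled on a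
finite-dimensional `E`, let `x` be a regular point of codimension `p` of `Z ⊆ M`
(`IsRegularPointOfCodim 𝓘(ℂ, E) Z p x`: near `x`, `Z = f⁻¹(0)` for a holomorphic
`f : M → ℂᵖ` with onto differential at `x`). Then there are a complex subspace `K ⊆ E` (the kernel
of the differential of the chart expression of `f` at `x`) and an open partial homeomorphism
`e : M ⇀ ℂᵖ × K` with `x ∈ e.source` such that `z ∈ Z ↔ (e z).1 = 0` for all `z ∈ e.source`. The
chart expression `g = f ∘ (chartAt x)⁻¹` is complex differentiable on an open set, hence analytic
(Osgood's lemma, the tree's `SCV.analyticAt_of_differentiableOn`), hence strictly differentiable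
with derivative the `mfderiv`; conclude by `exists_straightening_of_hasStrictFDerivAt`.
[cite: GriffithsHarrisPrinciples1978, Ch. 0 §2, smooth points] [cite: Chirka1989, §2.3] -/
theorem IsRegularPointOfCodim.exists_straightening {Z : Set M} {p : ℕ} {x : M}
    (h : IsRegularPointOfCodim 𝓘(ℂ, E) Z p x) :
    ∃ (K : Submodule ℂ E) (e : OpenPartialHomeomorph M ((Fin p → ℂ) × K)), x ∈ e.source ∧
      ∀ z ∈ e.source, z ∈ Z ↔ (e z).1 = 0 := by
  obtain ⟨U, hU, hxU, f, hf, hZU, hsurj⟩ := h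
  set φ := chartAt E x with hφ
  have hxφ : x ∈ φ.source := mem_chart_source E x
  -- the chart expression `g = f ∘ φ⁻¹` is complex differentiable on the open `φ(U ∩ φ.source)`
  set W : Set M := U ∩ φ.source with hWdef
  have hW : IsOpen W := hU.inter φ.open_source
  have hxW : x ∈ W := ⟨hxU, hxφ⟩
  have hmd : MDifferentiableOn 𝓘(ℂ, E) 𝓘(ℂ, Fin p → ℂ) f W := hf.mono inter_subset_left
  have hdiff : DifferentiableOn ℂ (f ∘ φ.symm) (φ '' W) := by
    have key := (mdifferentiableOn_iff_of_mem_maximalAtlas (I := 𝓘(ℂ, E)) (I' := 𝓘(ℂ, Fin p → ℂ))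
      (e := φ) (e' := chartAt (Fin p → ℂ) (f x)) (f := f) (s := W) (IsManifold.chart_mem_maximalAtlas x)
      (IsManifold.chart_mem_maximalAtlas (f x)) inter_subset_right (fun z _ ↦ by simp)).1 hmd
    have h2 := key.2
    simp only [OpenPartialHomeomorph.extend_coe, OpenPartialHomeomorph.extend_coe_symm,
      modelWithCornersSelf_coe, modelWithCornersSelf_coe_symm, chartAt_self_eq,
      OpenPartialHomeomorph.refl_apply, Function.id_comp, Function.comp_id] at h2
    exact h2
  have hopen : IsOpen (φ '' W) := by
    rw [hWdef, inter_comm, φ.image_source_inter_eq']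
    exact φ.isOpen_inter_preimage_symm hU
  have hxW' : φ x ∈ φ '' W := mem_image_of_mem φ hxW
  -- hence analytic (Osgood), hence strictly differentiable at `φ x`
  have han : AnalyticAt ℂ (f ∘ φ.symm) (φ x) :=
    Literature.Analysis.Complex.SCV.analyticAt_of_differentiableOn hdiff hopen hxW'
  have hstrict : HasStrictFDerivAt (f ∘ φ.symm) (fderiv ℂ (f ∘ φ.symm) (φ x)) (φ x) :=
    (han.contDiffAt (n := 1)).hasStrictFDerivAt one_ne_zero
  -- its derivative is the `mfderiv`, which is onto
  have hmdx : MDifferentiableAt 𝓘(ℂ, E) 𝓘(ℂ, Fin p → ℂ) f x := hf.mdifferentiableAt (hU.mem_nhds hxU)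
  have hmf : mfderiv 𝓘(ℂ, E) 𝓘(ℂ, Fin p → ℂ) f x = fderiv ℂ (f ∘ φ.symm) (φ x) := by
    rw [hmdx.mfderiv, ModelWithCorners.range_eq_univ, fderivWithin_univ]
    rfl
  have hsurj' : (fderiv ℂ (f ∘ φ.symm) (φ x)).range = ⊤ := by
    rw [← hmf]
    exact LinearMap.range_eq_top.2 hsurj
  -- `Z = {f = 0}` on `W`
  have hS : ∀ z ∈ W, z ∈ Z ↔ (f ∘ φ.symm) (φ z) = 0 := by
    intro z hz
    rw [Function.comp_apply, φ.left_inv hz.2]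
    have hz' := Set.ext_iff.1 hZU z
    simp only [mem_inter_iff, mem_preimage, mem_singleton_iff] at hz'
    constructor
    · exact fun hzZ ↦ (hz'.1 ⟨hzZ, hz.1⟩).2
    · exact fun h0 ↦ (hz'.2 ⟨hz.1, h0⟩).1
  obtain ⟨e, hxe, he⟩ := exists_straightening_of_hasStrictFDerivAt φ hW hxW inter_subset_right
    hstrict hsurj' hS
  exact ⟨_, e, hxe, he⟩

end Complex

end Literature.Geometry.Kaehler

end
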